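import Mathlib
import Literature.MathematicalPhysics.QuantumFieldTheory.Balaban1983to89.B5Transfer132
import Literature.MathematicalPhysics.QuantumFieldTheory.Balaban1983to89.B5Local114

/-!
# B5 Prop. 1.2 for G — the printed chain of pp. 36–40 COMPOSED end to end
# (B4 Theorem + Lemma 2.4, Prop. 1.1 for G₀ and G, the leaf (1.126)–(1.127), located leaves ⟹ (1.110)–(1.114))

Source: T. Bałaban, *Propagators and renormalization transformations for lattice gauge theories. I*,
Commun. Math. Phys. **95** (1984) 17–40 (`Balaban1984PropagatorsI`, "B5"), Sect. E, pp. 36–40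
[PDF 20–24]; renders `b2b-balaban-ref1/pages/1984-cmp95-propagators-rt-I/…-p021-x2.png` (journal p. 37,
(1.121)) and `…-p023-x2.png` (journal p. 39) read as images this session.  A typed skeleton of PUBLISHED work under line-by-line audit by the
pub-balaban cell; the value of this file is a kernel-checked BOOKKEEPING EDGE (the census of what remains
a hypothesis after the b05 lineage's modules), NOT summit progress.

## What the paper prints (p. 39, verbatim)

«This proof, and also a proof of (1.115)–(1.117), makes use of the identity
G = G₀ + G₀∂P∂*G, (1.132)
where G₀ = (Δ + aQ*Q)⁻¹. This operator is similar to G′, but with the different averaging operator. We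
will prove (1.115)–(1.117), and in fact the whole Proposition 1.2, for the operator G₀. This together with
the properties (1.126), (1.127) of ∂P∂* and (1.89), or (1.114) for the operator G implies immediately
(1.115)–(1.117), or Proposition 1.2 for G.»

«We only have to know some weak bounds for G₀, for example bounds in the L²-norm (1.89), or (1.114).»

«Thus its momentum representation is given by (1.87) and we have Proposition 1.1 for G₀. This leads also
to (1.114) by the same reasoning with a random walk expansion as for G.»

## What is composed here (kernel-checked, zero sorry; no new analysis)

The b05 lineage typed the chain as follows: `B5.prop12_of_printed_steps` (gen 1: the four printed steps
S1′, S3, S2, S1 as named hypotheses); `B5Transfer133.prop12G0_of_B4_via133` (gen 3: S3 = Prop. 1.2 for G₀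
from B4's Theorem and Lemma 2.4 through (1.133)–(1.137), taking the two printed sentences about G₀ —
Prop. 1.1 for G₀ (`h11G0`) and «This leads also to (1.114) by the same reasoning with a random walk
expansion as for G» (`h114G0`) — as hypotheses); `B5Transfer132.prop12_of_B4_via132` (gen 3: the (1.132)
transfer, still taking `h114G0` and `S1'`); `B5Local114.local114_of_realisation` (gen 4: the L² random-walk
expansion (1.118)–(1.131) itself, `Prop11Printed fam → Kernel126_127Printed Kd → Local114Fam fam`, from a
`Realisation` per instance and cube scale = located printed-shape leaves, GAPS G-B5-24).

This file plugs gen 4 into gen 3: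

* `zeroKernel`, `kernel126_127_zeroKernel` — for **G₀ = (Δ + aQ*Q)⁻¹ there is no ∂P∂* term**: the
  commutator of the walk is K₀(h) = h(Δ + aQ*Q) − (Δ + aQ*Q)h, i.e. the bracket of (1.121) p. 37
  «Δ_a hA = (Δ − ∂P∂* + aQ*Q)hA = hΔ_aA − [Σ_{b∈st(·)}(∂h)(b)(∂A)(b) − (Δh)A + S*(∂h)QA − Q*S(∂h)A + P₁(∂h)A]
  = hΔ_aA − K(h)A» WITHOUT its last term P₁(∂h)A (the ∂P∂*-commutator computed in (1.120)) — a LOCAL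
  operator with coefficients ∂h = O(M₀⁻¹), Δh = O(M₀⁻²).  In `B5Local114.Realisation` the kernel enters
  only as the PREMISE of the field `h128`; for G₀ that premise is discharged by the identically-zero kernel
  (which satisfies (1.126)–(1.127) trivially), so that `h128` for the G₀-realisation is the honest located
  leaf «(1.128) for K₀ in L²» with no kernel input.  Nothing is claimed about ∂P∂* here.
* `local114_noKernel : Prop11Printed fam → Local114Fam fam` for any family carrying such a kernel-free
  realisation — the sentence «This leads also to (1.114) by the same reasoning with a random walk expansion
  as for G» BY TYPE (it is the `h114G0` slot of `B5Transfer132.prop12_of_B4_via132`).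
* `prop12_via132_walk` — `B5Transfer132.prop12_via132_of_printed_steps` with the slot S1′ discharged by
  `B5Local114.local114_of_realisation`.
* `prop12_of_B4_walk` — `B5Transfer132.prop12_of_B4_via132` with BOTH (1.114)-slots (`h114G0`, `S1'`)
  discharged.  After this composition the hypotheses standing for PRINTED MATHEMATICS NOT FORMALISED in
  the B4 → B5 chain for Prop. 1.2 ((1.110)–(1.114)) for G are exactly:
  `hThm` (B4's Theorem with the printed dependence, `B5FromB4.ThmDepPrinted`), `h24` (B4 Lemma 2.4,
  `B4.Lemma24Printed`), `h11G0`, `h11` (Prop. 1.1 for G₀ and for G, `B5.Prop11Printed` — the T02.1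
  lineage's target), `hleaf` ((1.126)–(1.127), `B5.Kernel126_127Printed` — imported from B4 BY METHOD,
  GAPS C-B5-6 / G-B5-06a); everything else is a LOCATED LEAF of printed shape (the structure hypotheses of
  `B5Ineq137` / `B5Ineq113` / `B5Ineq110Gp` / `B5Transfer133` / `B5Transfer132`, and the two `Realisation`
  families `real₀`, `real` of `B5Local114`, GAPS G-B5-24) or a sign / model-evident fact.

## What this file does NOT claim

No torus operator theory is formalised; no `Realisation` is constructed (that is the instantiation
contract for the T02.1 model lineage); (1.115)–(1.117) (Hölder) are not derived — `B5.Prop12Printed` is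
(1.110)–(1.114) as typed by gen 1; the leaf (1.126)–(1.127) stays a hypothesis.  DEVIATIONS: none beyond
those recorded for the imported modules (D-b05g3.*, D-b05g4.1).
-/

namespace Literature.MathematicalPhysics.QuantumFieldTheory.Balaban1983to89.B5Prop12Chain

open Finset B5FromB4 B5Transfer133 B5Transfer132 B5Ineq137 B5Ineq113 B5Ineq110Gp B5Local114

noncomputable section

/-! ## 1. The kernel slot for G₀ is empty -/

/-- The identically-zero kernel on a one-point space: the (absent) ∂P∂*-part of the walk commutator for
**G₀ = (Δ + aQ*Q)⁻¹** (p. 39 «where G₀ = (Δ + aQ*Q)⁻¹»).  A bookkeeping device: `B5Local114.Realisation`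
mentions a `B5.KernelData` only in the premise of its field `h128`. [cite: Balaban1984PropagatorsI, p.39] -/
def zeroKernel : B5.KernelData where
  X := Unit
  dist := fun _ _ => 0
  ker := fun _ _ => 0

/-- The zero kernel satisfies the printed shape (1.126)–(1.127) (`B5.Kernel126_127Printed`) trivially
(constants δ′₀ = C = 1, C_α = 0).  This is NOT a statement about ∂P∂*; it only discharges the kernel
premise of `B5Local114.local114_of_realisation` in the kernel-free case G₀ = (Δ + aQ*Q)⁻¹ of p. 39.
[cite: Balaban1984PropagatorsI, p.39] -/
theorem kernel126_127_zeroKernel (I : Type) : B5.Kernel126_127Printed (fun _ : I => zeroKernel) := by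
  refine ⟨1, 1, fun _ => 0, one_pos, one_pos, fun i => ⟨?_, ?_⟩⟩
  · intro x x'
    simp [zeroKernel]
  · intro α x x' x'' _ _
    simp [zeroKernel]

/-! ## 2. (1.114) for a kernel-free operator: the `h114G0` slot -/

/-- **p. 39, verbatim: «Thus its momentum representation is given by (1.87) and we have Proposition 1.1
for G₀. This leads also to (1.114) by the same reasoning with a random walk expansion as for G.»** — BY
TYPE, for any family `fam` (read: `famG0`, G₀ = (Δ + aQ*Q)⁻¹) equipped, for every instance and every cube
scale M₀ ≥ 1, with a `B5Local114.Realisation` over the ZERO kernel (so its field `h128` is the located leaf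
«(1.128) for K₀(h) = h(Δ + aQ*Q) − (Δ + aQ*Q)h in L²» — the bracket of (1.121) without the term P₁(∂h)A, a
local operator with coefficients ∂h = O(M₀⁻¹), Δh = O(M₀⁻²) — and its fields `h71`/`h71'` read
«G₀ = (Δ + aQ*Q)⁻¹»): Prop. 1.1 for the family implies (1.114) for it, by
`B5Local114.local114_of_realisation` (the same kernel-checked walk expansion (1.118)–(1.131) as for G).
This is the hypothesis `h114G0` of `B5Transfer133.prop12G0_of_B4_via133` /
`B5Transfer132.prop12_of_B4_via132`. [cite: Balaban1984PropagatorsI, p.39] -/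
theorem local114_noKernel {I : Type} (fam : I → B5.Setting) (κ : Consts)
    {V : I → ℕ → Type} [∀ i M, NormedAddCommGroup (V i M)] [∀ i M, InnerProductSpace ℝ (V i M)]
    {X : I → ℕ → Type} [∀ i M, PseudoMetricSpace (X i M)]
    {S : I → ℕ → Type} [∀ i M, Fintype (S i M)]
    (real : ∀ (i : I) (M₀ : ℕ), 1 ≤ M₀ →
      Realisation (fam i) zeroKernel M₀ κ (V i M₀) (X i M₀) (S i M₀)) :
    B5.Prop11Printed fam → B5.Local114Fam fam :=
  fun h11 => local114_of_realisation fam (fun _ : I => zeroKernel) κ real h11 (kernel126_127_zeroKernel I)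

/-! ## 3. The (1.132) route with S1′ discharged -/

/-- **`B5Transfer132.prop12_via132_of_printed_steps` with the printed step S1′ DISCHARGED** by the
kernel-checked L² walk expansion of `B5Local114`: Prop. 1.2 ((1.110)–(1.114)) for G from Prop. 1.1 for G
(`h11`), the leaf (1.126)–(1.127) (`hleaf`), S3 = Prop. 1.2 for G₀ (`S3`), the located leaves of the
(1.132) transfer (gen 3) and a `B5Local114.Realisation` of the walk for G per instance and cube scale
(`real`, located leaves G-B5-24).  p. 39: «This together with the properties (1.126), (1.127) of ∂P∂* and
(1.89), or (1.114) for the operator G implies immediately (1.115)–(1.117), or Proposition 1.2 for G.»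
[cite: Balaban1984PropagatorsI, pp.36–40] -/
theorem prop12_via132_walk {I : Type} (fam famG0 : I → B5.Setting) (Kd : I → B5.KernelData)
    (h11 : B5.Prop11Printed fam) (hleaf : B5.Kernel126_127Printed Kd)
    (κ : Consts)
    {V : I → ℕ → Type} [∀ i M, NormedAddCommGroup (V i M)] [∀ i M, InnerProductSpace ℝ (V i M)]
    {X : I → ℕ → Type} [∀ i M, PseudoMetricSpace (X i M)]
    {S : I → ℕ → Type} [∀ i M, Fintype (S i M)]
    (real : ∀ (i : I) (M₀ : ℕ), 1 ≤ M₀ →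
      Realisation (fam i) (Kd i) M₀ κ (V i M₀) (X i M₀) (S i M₀))
    (S3 : B5.Prop12Printed famG0)
    (Kf : ∀ i, Carrier133 (famG0 i) (fam i)) (Kc : ∀ i, KerCarrier (Kd i) (fam i)) {A B c₀ r0 Nn Dh : ℝ}
    (Mf : ∀ i, MapFacts (Kf i) r0 Nn) (Pf : ∀ i, PieceFacts132 (Kf i) (Kc i) A B c₀)
    (Dp : ∀ i, Display133 (Kf i) Dh) (SgG0 : ∀ i, B5FromB4.ModelSigns (famG0 i))
    (SgG : ∀ i, B5FromB4.ModelSigns (fam i))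
    (hRow : ∀ κ' : ℝ, 0 < κ' → ∃ Λ : ℝ, ∀ i, URow (Kf i) κ' Λ) :
    B5.Prop12Printed fam :=
  prop12_via132_of_printed_steps fam famG0 Kd h11 hleaf (local114_of_realisation fam Kd κ real)
    S3 Kf Kc Mf Pf Dp SgG0 SgG hRow

/-! ## 4. The whole B4 → B5 chain with both (1.114)-slots discharged -/

/-- **The whole B4 → B5 chain for Proposition 1.2 ((1.110)–(1.114)) for G = G(Ω), with BOTH L²
random-walk slots discharged** — `B5Transfer132.prop12_of_B4_via132` with
`h114G0 := local114_noKernel famG0 κ₀ real₀` (the walk for G₀ = (Δ + aQ*Q)⁻¹, zero kernel) and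
`S1' := B5Local114.local114_of_realisation fam Kd κ real` (the walk for G, kernel (1.126)).
The hypotheses standing for PRINTED MATHEMATICS NOT FORMALISED are now exactly: `hThm`, `h24` (B4's Theorem
with the printed dependence and Lemma 2.4, BY NAME), `h11G0`, `h11` (Prop. 1.1 for G₀ and for G), `hleaf`
((1.126)–(1.127), imported from B4 by method); everything else is a located leaf of printed shape (the
structure hypotheses of gens 2–3 and the two `Realisation` families of gen 4) or a sign / model-evident
fact.  p. 39: «We will prove (1.115)–(1.117), and in fact the whole Proposition 1.2, for the operator G₀.
This together with the properties (1.126), (1.127) of ∂P∂* and (1.89), or (1.114) for the operator G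
implies immediately (1.115)–(1.117), or Proposition 1.2 for G.» [cite: Balaban1984PropagatorsI, pp.36–40] -/
theorem prop12_of_B4_walk {I I₄ I₂₄ : Type} (fam₄ : I₄ → B4.EtaSetting)
    (fam₂₄ : I₂₄ → B4.ScaleSetting) (fam famGp famG0 : I → B5.Setting) (Kd : I → B5.KernelData)
    (F : ∀ i, B5FromB4.GpHolder (famGp i)) (c : ℝ) (ι : I → ℝ → I₄)
    (Dι : ∀ (i : I) (e : ℝ), 0 < e → B5FromB4.Dict (fam₄ (ι i e)) (famGp i) (F i) c e)
    (SgGp : ∀ i, B5FromB4.ModelSigns (famGp i)) (SgG0 : ∀ i, B5FromB4.ModelSigns (famG0 i))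
    (SgG : ∀ i, B5FromB4.ModelSigns (fam i))
    (hThm : B5FromB4.ThmDepPrinted fam₄) (h24 : B4.Lemma24Printed fam₂₄)
    (Dfam : ∀ i, ScaleData (famGp i)) (Pfam : ∀ i, GpData (Dfam i)) (L : ℝ) (d : ℕ)
    (cc cb ā aK s₀ pL : ℝ) (hL : 1 < L) (hs₀ : 0 ≤ s₀) (hpL : 0 ≤ pL) (haK : 0 ≤ aK)
    (ha : ∀ i j, |(Dfam i).a j| ≤ ā)
    (h136 : ∀ i, Display136 (Dfam i) L d) (Z : ∀ i, RowZero (Dfam i))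
    (h135R : ∀ i, Display135 (dataR (Dfam i) (Pfam i)) L d 1)
    (h135Z : ∀ i, Display135 (dataZ (Dfam i) (Pfam i)) L d 2)
    (D24 : ∀ i, Dict24 fam₂₄ (Dfam i) L s₀) (D236 : ∀ i, Dict236 fam₂₄ (Dfam i) L)
    (D24G : ∀ i, Dict24Gp fam₂₄ (Dfam i) (Pfam i) L s₀ pL)
    (Lap : ∀ i, LaplaceLeaf (Dfam i) (Pfam i) aK cb)
    (Dc : ∀ i, Dict137 (Dfam i) d) (Dc' : ∀ i, Dict113 (Dfam i) d)
    (DG : ∀ i, DictGp (Dfam i) (Pfam i) (F i) d)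
    (G : ∀ i, Geometry (Dfam i) L cc) (G' : ∀ i, Geometry113 (Dfam i) L)
    (hRow : ∀ κ' : ℝ, 0 < κ' → ∃ R Λ : ℝ, ∀ i, RowSums (Dfam i) L d κ' R Λ)
    (N : ∀ i, NormFacts (Dfam i))
    (h11G0 : B5.Prop11Printed famG0)
    (κ₀ : Consts)
    {V₀ : I → ℕ → Type} [∀ i M, NormedAddCommGroup (V₀ i M)] [∀ i M, InnerProductSpace ℝ (V₀ i M)]
    {X₀ : I → ℕ → Type} [∀ i M, PseudoMetricSpace (X₀ i M)]
    {S₀ : I → ℕ → Type} [∀ i M, Fintype (S₀ i M)]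
    (real₀ : ∀ (i : I) (M₀ : ℕ), 1 ≤ M₀ →
      Realisation (famG0 i) zeroKernel M₀ κ₀ (V₀ i M₀) (X₀ i M₀) (S₀ i M₀))
    (Kf : ∀ i, Carrier133 (famGp i) (famG0 i)) {A B r0 Nn Dh : ℝ}
    (Fk : ∀ i, CarrierFacts (Kf i) A B r0 Nn) (Dp : ∀ i, Display133 (Kf i) Dh)
    (hRowU : ∀ κ' : ℝ, 0 < κ' → ∃ Λ : ℝ, ∀ i, URow (Kf i) κ' Λ)
    (h11 : B5.Prop11Printed fam) (hleaf : B5.Kernel126_127Printed Kd)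
    (κ : Consts)
    {V : I → ℕ → Type} [∀ i M, NormedAddCommGroup (V i M)] [∀ i M, InnerProductSpace ℝ (V i M)]
    {X : I → ℕ → Type} [∀ i M, PseudoMetricSpace (X i M)]
    {S : I → ℕ → Type} [∀ i M, Fintype (S i M)]
    (real : ∀ (i : I) (M₀ : ℕ), 1 ≤ M₀ →
      Realisation (fam i) (Kd i) M₀ κ (V i M₀) (X i M₀) (S i M₀))
    (Kg : ∀ i, Carrier133 (famG0 i) (fam i)) (Kc : ∀ i, KerCarrier (Kd i) (fam i))
    {A₂ B₂ c₀ r₂ N₂ D₂ : ℝ} (Mg : ∀ i, MapFacts (Kg i) r₂ N₂) (Pg : ∀ i, PieceFacts132 (Kg i) (Kc i) A₂ B₂ c₀)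
    (Dg : ∀ i, Display133 (Kg i) D₂) (hRowG : ∀ κ' : ℝ, 0 < κ' → ∃ Λ : ℝ, ∀ i, URow (Kg i) κ' Λ) :
    B5.Prop12Printed fam :=
  prop12_of_B4_via132 fam₄ fam₂₄ fam famGp famG0 Kd F c ι Dι SgGp SgG0 SgG hThm h24 Dfam Pfam L d cc cb ā
    aK s₀ pL hL hs₀ hpL haK ha h136 Z h135R h135Z D24 D236 D24G Lap Dc Dc' DG G G' hRow N h11G0
    (local114_noKernel famG0 κ₀ real₀) Kf Fk Dp hRowU h11 hleaf (local114_of_realisation fam Kd κ real)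
    Kg Kc Mg Pg Dg hRowG

end

end Literature.MathematicalPhysics.QuantumFieldTheory.Balaban1983to89.B5Prop12Chain
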